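import Mathlib
import Summits.Ventures.HodgeRepro.Tier4.Common.AdelicRTF
import Summits.Ventures.HodgeRepro.Tier4.Common.AdelicHaar
import Summits.Ventures.HodgeRepro.Tier4.Common.LocalTorus
import Summits.Ventures.HodgeRepro.Tier4.Line1.FiniteLevelIsolation
import Summits.Ventures.HodgeRepro.Tier4.Line1.LocallyCompactGA
import Summits.Ventures.HodgeRepro.Tier4.Line1.SecondCountableGA
import Summits.Ventures.HodgeRepro.Tier4.Line4.TorusProduct
import Summits.Ventures.HodgeRepro.Tier4.Line4.InnerSplit

/-!
# Tier4/Line4/FiniteSum — C-L4-FINSUM: the finite factor of the unfolded orbital term has POSITIVE real part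

Blind re-derivation cell `pub-hodge-repro`, Tier 4 «PROVE THE STEP» (README §9–§10), LINE L4, cut C-L4-FINSUM = Part 5 of
t4-plan-4 g3's factorisation chain of the `horb` residual (Factorisation-STATEMENTS-v2.lean 777b21f7ec8bf57d, S14430,
reaffirmed S14455); seat t4-L2-p3 (gen 4).  Statement VERBATIM from the planner's file.

THE CLAIM.  After C-L4-PRODINT the unfolded orbital term is `(c c′) · (∫_{T_∞} χ I_∞) · (∫_{DZ_f} χ(b) I_f(b) dν_f)`, with
`I_f(b) = ∫_{T′_f} conj χ′(b′) F_f(b⁻¹ γ₀,f b′) dν′_f` (`innerFin`, C-L4-INNERSPLIT).  For a REAL, NON-NEGATIVE finite test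
function `F_f` whose support meets `DZ_f × T′_f` in positive measure, and with `Re(χ(b) conj χ′(b′)) > 0` wherever
`F_f(b⁻¹ γ₀,f b′) ≠ 0` on `DZ_f × T′_f` (the output of C-L4-FINPOS′ p693462 on the compact closures), the finite factor has
POSITIVE REAL PART — so it cannot cancel the archimedean factor, and the `horb` chain reduces to the displayed archimedean
input `∫_{T_∞} χ I_∞ ≠ 0` (plus the CM / domain inputs of Part 6 and the bookkeeping cuts).

PROOF (`re_setIntegral_chi_innerFin_pos`).  (A) `χ(b) I_f(b) = ∫_{b′} g(b, b′)` with `g(b, b′) = χ(b) conj χ′(b′) F_f(b⁻¹ γ₀,f b′)`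
(`integral_const_mul`); (B) Fubini on `DZ_f × T′_f`: `∫_{DZ_f} ∫_{T′_f} g = ∫ g d((ν_f|_{DZ_f}) ⊗ ν′_f)`
(`integral_prod`; `(ν_f|_{DZ_f}) ⊗ ν′_f = (ν_f ⊗ ν′_f)|_{DZ_f × T′_f}` is `Measure.restrict_prod_eq_prod_univ`, which turns
the displayed `IntegrableOn` into integrability for the product measure) — the σ-finiteness Fubini needs comes from the
factor tori being locally compact (closed in the locally compact `T(𝔸)`, `T′(𝔸)`: `isClosed_finitePart` of InnerSplit,
`isClosed_torusFin` here) and second countable (subspaces of `G(𝔸)`, `secondCountable_GA`); (C) the real part passes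
inside the integral (`integral_re`); (D) `Re g = Re(χ conj χ′) · Re F_f` (`F_f` real), which is `≥ 0` a.e. on the product
measure (a.e. `b ∈ DZ_f`, where `hpos` applies whenever `F_f ≠ 0`) and `> 0` exactly where `F_f ≠ 0`; so
`Function.support (Re g)` carries `{F_f ≠ 0}` up to a null set, and `integral_pos_iff_support_of_nonneg_ae` with `hsupp`
gives `0 < ∫ Re g`.

THE SUPPORT INPUT (`prod_measure_support_pos_of_levelDoubleCoset`, self-cut C-L4-FINSUPP).  `hsupp` holds for every finite
test function that does not vanish on the double coset `K(N) γ₀,f K(N)` (`N ≠ 0`) as soon as `DZ_f` contains a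
neighbourhood of `1` (Part 6's domain does): the support set contains `(V ∩ K(N)) × (T′_f ∩ K(N))` for an open `1 ∈ V ⊆ DZ_f`
— the trace of `K(N)` on `T_f`, `T′_f` is open (`isOpen_coe_mem_levelK`, via `preimage_levelK_eq` and `isOpen_finCongr`) and
contains `1` — a product of two non-empty open sets, of positive Haar measure (`Measure.prod_prod`, `IsOpen.measure_pos`).

WHAT IT IS NOT.  The positivity `hpos` of the character product is FINPOS′ (t4-L4-p2 g3, p693462), consumed as a displayed
hypothesis; the integrability `hint` is the consumer's (the projected bump is compactly supported and continuous; its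
support in `DZ_f × T′_f` is controlled by Part 6's relative compactness on `Z_f`-saturations); the non-vanishing of the
level average of `1_{γ₀,f K(N)}` on `K(N) γ₀,f K(N)` is PROJPROD's business.  No printed input is consumed; nothing here
asserts anything about the truth of (P); HC_CM is NOT proved by anyone in this repository.
-/

set_option autoImplicit false

noncomputable section

namespace Summit.Ventures.HodgeRepro.Tier4.Line4

open Summit.Ventures.HodgeRepro.Tier4 Summit.Ventures.HodgeRepro.Tier4.Common
  Summit.Ventures.HodgeRepro.Tier4.Line1 MeasureTheory
open scoped ComplexConjugate Topology Pointwise NNReal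

/-! ## Part 5 — C-L4-FINSUM (t4-L2-p3 g4): the finite factor has POSITIVE real part -/

section FinSumHelpers
variable {k : Type} [Field k] [NumberField k] (W : PlaneData k)

/-- `T_f` is closed in `T(𝔸_k)` (twin of `isClosed_torusFin'`). -/
theorem isClosed_torusFin : IsClosed ((torusFin W : Set (torusT W))) :=
  (isClosed_finitePart W).preimage continuous_subtype_val

/-- The real part of a product with a REAL number is the product of the real parts. -/
theorem re_mul_of_im_eq_zero (w z : ℂ) (hz : z.im = 0) : (w * z).re = w.re * z.re := by
  rw [Complex.mul_re, hz, mul_zero, sub_zero]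

/-- A real non-negative complex number which is not `0` has positive real part. -/
theorem re_pos_of_im_eq_zero_of_ne_zero {z : ℂ} (hz : z.im = 0) (hnn : 0 ≤ z.re) (h0 : z ≠ 0) : 0 < z.re := by
  rcases hnn.lt_or_eq with h | h
  · exact h
  · exact absurd (Complex.ext h.symm hz) h0

end FinSumHelpers

section FinSum
variable {k : Type} [Field k] [NumberField k] (W : PlaneData k)
  [MeasurableSpace (torusT W)] [MeasurableSpace (torusT' W)] (R : RTFData W)

/-- **C-L4-FINSUM — the finite factor has POSITIVE real part**: for a real non-negative `F_f` whose support meets the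
domain in positive measure, with `Re(χ(b) conj χ′(b′)) > 0` wherever `F_f(b⁻¹ γ₀,f b′) ≠ 0` (FINPOS′ p693462 on the
compact closures), `Re ∫_{DZ_f} χ(b) I_f(b) dν_f > 0` (Fubini on `DZ_f × T′_f`, the integrand's real part is
`F_f · Re(χ conj χ′) ≥ 0`, positive on a set of positive measure). -/
theorem re_setIntegral_chi_innerFin_pos [BorelSpace (torusT W)] [BorelSpace (torusT' W)]
    (νf : Measure (torusFin W)) [νf.IsHaarMeasure] (νf' : Measure (torusFin' W)) [νf'.IsHaarMeasure]
    (Ffin : GA W → ℂ) (hreal : ∀ g, (Ffin g).im = 0) (hnonneg : ∀ g, 0 ≤ (Ffin g).re)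
    (γ₀ : GA W) (DZf : Set (torusFin W)) (hDZf : MeasurableSet DZf)
    (hpos : ∀ b ∈ DZf, ∀ b' : torusFin' W,
      Ffin ((((b : torusT W) : GA W))⁻¹ * GA.ofFinPart W γ₀ * ((b' : torusT' W) : GA W)) ≠ 0 →
      0 < (R.chi b * conj (R.chi' b')).re)
    (hint : IntegrableOn (fun p : torusFin W × torusFin' W => R.chi p.1 * conj (R.chi' p.2) *
      Ffin ((((p.1 : torusT W) : GA W))⁻¹ * GA.ofFinPart W γ₀ * ((p.2 : torusT' W) : GA W)))
      (DZf ×ˢ Set.univ) (νf.prod νf'))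
    (hsupp : 0 < (νf.restrict DZf).prod νf' {p : torusFin W × torusFin' W |
      Ffin ((((p.1 : torusT W) : GA W))⁻¹ * GA.ofFinPart W γ₀ * ((p.2 : torusT' W) : GA W)) ≠ 0}) :
    0 < (∫ b in DZf, R.chi b * innerFin W R Ffin γ₀ νf' b ∂νf).re := by
  -- the factor tori are locally compact and second countable, so the Haar measures are σ-finite (Fubini)
  haveI := locallyCompact_GA W
  haveI := secondCountable_GA W
  haveI := locallyCompactSpace_torusT W
  haveI := locallyCompactSpace_torusT' W
  haveI : SecondCountableTopology (torusT W) :=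
    TopologicalSpace.Subtype.secondCountableTopology (torusT W : Set (GA W))
  haveI : SecondCountableTopology (torusT' W) :=
    TopologicalSpace.Subtype.secondCountableTopology (torusT' W : Set (GA W))
  haveI : SecondCountableTopology (torusFin W) :=
    TopologicalSpace.Subtype.secondCountableTopology (torusFin W : Set (torusT W))
  haveI : SecondCountableTopology (torusFin' W) :=
    TopologicalSpace.Subtype.secondCountableTopology (torusFin' W : Set (torusT' W))
  haveI : LocallyCompactSpace (torusFin W) := (isClosed_torusFin W).locallyCompactSpace
  haveI : LocallyCompactSpace (torusFin' W) := (isClosed_torusFin' W).locallyCompactSpace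
  haveI : IsLocallyFiniteMeasure νf := isLocallyFiniteMeasure_of_isFiniteMeasureOnCompacts
  haveI : IsLocallyFiniteMeasure νf' := isLocallyFiniteMeasure_of_isFiniteMeasureOnCompacts
  haveI : SigmaFinite νf := sigmaFinite_of_locallyFinite
  haveI : SigmaFinite νf' := sigmaFinite_of_locallyFinite
  -- the integrand on `DZ_f × T′_f` and the product measure
  set g : torusFin W × torusFin' W → ℂ := fun p => R.chi p.1 * conj (R.chi' p.2) *
    Ffin ((((p.1 : torusT W) : GA W))⁻¹ * GA.ofFinPart W γ₀ * ((p.2 : torusT' W) : GA W)) with hg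
  set μ : Measure (torusFin W × torusFin' W) := (νf.restrict DZf).prod νf' with hμ
  have hμ' : μ = (νf.prod νf').restrict (DZf ×ˢ Set.univ) := Measure.restrict_prod_eq_prod_univ DZf
  have hgint : Integrable g μ := by rw [hμ']; exact hint
  -- (A)+(B): the set integral of `χ · I_f` is the integral of `g` over `DZ_f × T′_f` (Fubini)
  have hEq : ∫ b in DZf, R.chi b * innerFin W R Ffin γ₀ νf' b ∂νf = ∫ p, g p ∂μ := by
    rw [hμ, integral_prod g hgint]
    refine integral_congr_ae (Filter.Eventually.of_forall fun b => ?_)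
    simp only [innerFin, hg]
    rw [← integral_const_mul]
    refine integral_congr_ae (Filter.Eventually.of_forall fun b' => ?_)
    ring
  -- (C): the real part passes inside
  have hRe : (∫ p, g p ∂μ).re = ∫ p, (g p).re ∂μ := by
    have h := integral_re hgint
    simpa only [RCLike.re_to_complex] using h.symm
  -- a.e. on `μ` the first coordinate lies in `DZ_f`
  have hae : ∀ᵐ p ∂μ, p.1 ∈ DZf := by
    rw [hμ']
    filter_upwards [ae_restrict_mem (hDZf.prod MeasurableSet.univ)] with p hp
    exact hp.1
  -- the real part of `g` is `Re(χ conj χ′) · Re F_f`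
  have hre_g : ∀ p : torusFin W × torusFin' W, (g p).re = (R.chi p.1 * conj (R.chi' p.2)).re *
      (Ffin ((((p.1 : torusT W) : GA W))⁻¹ * GA.ofFinPart W γ₀ * ((p.2 : torusT' W) : GA W))).re :=
    fun p => re_mul_of_im_eq_zero _ _ (hreal _)
  -- (D1): non-negativity a.e.
  have hnn : 0 ≤ᵐ[μ] fun p => (g p).re := by
    filter_upwards [hae] with p hp
    show 0 ≤ (g p).re
    rw [hre_g]
    by_cases h0 : Ffin ((((p.1 : torusT W) : GA W))⁻¹ * GA.ofFinPart W γ₀ * ((p.2 : torusT' W) : GA W)) = 0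
    · rw [h0, Complex.zero_re, mul_zero]
    · exact mul_nonneg (hpos p.1 hp p.2 h0).le (hnonneg _)
  -- (D2): the support of `Re g` carries the support of `F_f`
  have hsupp' : μ {p : torusFin W × torusFin' W |
      Ffin ((((p.1 : torusT W) : GA W))⁻¹ * GA.ofFinPart W γ₀ * ((p.2 : torusT' W) : GA W)) ≠ 0} ≤
      μ (Function.support fun p => (g p).re) := by
    refine measure_mono_ae ?_
    filter_upwards [hae] with p hp hF0
    change (g p).re ≠ 0
    rw [hre_g]
    exact (mul_pos (hpos p.1 hp p.2 hF0) (re_pos_of_im_eq_zero_of_ne_zero (hreal _) (hnonneg _) hF0)).ne'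
  rw [hEq, hRe, integral_pos_iff_support_of_nonneg_ae hnn hgint.re]
  exact lt_of_lt_of_le hsupp hsupp'

end FinSum


/-! ### The support input `hsupp` for a test function non-vanishing on `K(N) γ₀,f K(N)` (self-cut C-L4-FINSUPP) -/

section FinSupp
variable {k : Type} [Field k] [NumberField k] (W : PlaneData k)

/-- The trace of `K(N)` on `T_f`: `b ∈ T_f` lies in `K(N)` iff it satisfies the finite congruence conditions
(`preimage_levelK_eq`, since `T_f ⊆ G(𝔸_f)`). -/
theorem coe_mem_levelK_iff_mem_finCongr (N : ℕ) (b : torusFin W) :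
    ((b : torusT W) : GA W) ∈ levelK W N ↔ ((b : torusT W) : GA W) ∈ finCongr W N := by
  have hb : ((b : torusT W) : GA W) ∈ finitePart W := Subgroup.mem_subgroupOf.1 b.2
  have h := congrArg (fun S : Set (finitePart W) => (⟨_, hb⟩ : finitePart W) ∈ S) (preimage_levelK_eq W N)
  simpa only [Set.mem_preimage, SetLike.mem_coe, eq_iff_iff] using h

/-- The `T′_f` twin. -/
theorem coe_mem_levelK_iff_mem_finCongr' (N : ℕ) (b : torusFin' W) :
    ((b : torusT' W) : GA W) ∈ levelK W N ↔ ((b : torusT' W) : GA W) ∈ finCongr W N := by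
  have hb : ((b : torusT' W) : GA W) ∈ finitePart W := Subgroup.mem_subgroupOf.1 b.2
  have h := congrArg (fun S : Set (finitePart W) => (⟨_, hb⟩ : finitePart W) ∈ S) (preimage_levelK_eq W N)
  simpa only [Set.mem_preimage, SetLike.mem_coe, eq_iff_iff] using h

/-- The trace of `K(N)` on `T_f` is OPEN (`N ≠ 0`). -/
theorem isOpen_coe_mem_levelK {N : ℕ} (hN : N ≠ 0) :
    IsOpen {b : torusFin W | ((b : torusT W) : GA W) ∈ levelK W N} := by
  have : {b : torusFin W | ((b : torusT W) : GA W) ∈ levelK W N} =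
      (fun b : torusFin W => ((b : torusT W) : GA W)) ⁻¹' finCongr W N := by
    ext b
    exact coe_mem_levelK_iff_mem_finCongr W N b
  rw [this]
  exact (isOpen_finCongr W hN).preimage (continuous_subtype_val.comp continuous_subtype_val)

/-- The trace of `K(N)` on `T′_f` is OPEN (`N ≠ 0`). -/
theorem isOpen_coe_mem_levelK' {N : ℕ} (hN : N ≠ 0) :
    IsOpen {b : torusFin' W | ((b : torusT' W) : GA W) ∈ levelK W N} := by
  have : {b : torusFin' W | ((b : torusT' W) : GA W) ∈ levelK W N} =
      (fun b : torusFin' W => ((b : torusT' W) : GA W)) ⁻¹' finCongr W N := by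
    ext b
    exact coe_mem_levelK_iff_mem_finCongr' W N b
  rw [this]
  exact (isOpen_finCongr W hN).preimage (continuous_subtype_val.comp continuous_subtype_val)

variable [MeasurableSpace (torusT W)] [MeasurableSpace (torusT' W)]

/-- **C-L4-FINSUPP — the support input `hsupp` of FINSUM**: if `DZ_f` contains a neighbourhood of `1` (Part 6) and the
finite test function does not vanish on the double coset `K(N) γ₀,f K(N)` (`N ≠ 0`), then the pairs
`(b, b′) ∈ DZ_f × T′_f` with `F_f(b⁻¹ γ₀,f b′) ≠ 0` have POSITIVE `(ν_f|_{DZ_f}) ⊗ ν′_f`-measure: they contain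
`(V ∩ K(N)) × (T′_f ∩ K(N))` for an open `1 ∈ V ⊆ DZ_f`, a product of two non-empty open sets, each of positive Haar
measure. -/
theorem prod_measure_support_pos_of_levelDoubleCoset [BorelSpace (torusT W)] [BorelSpace (torusT' W)]
    (νf : Measure (torusFin W)) [νf.IsHaarMeasure] (νf' : Measure (torusFin' W)) [νf'.IsHaarMeasure]
    (Ffin : GA W → ℂ) (γ₀ : GA W) {N : ℕ} (hN : N ≠ 0)
    (hF : ∀ x ∈ levelDoubleCoset W N (GA.ofFinPart W γ₀), Ffin x ≠ 0)
    (DZf : Set (torusFin W)) (hU : ∃ U ∈ 𝓝 (1 : torusFin W), U ⊆ DZf) :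
    0 < (νf.restrict DZf).prod νf' {p : torusFin W × torusFin' W |
      Ffin ((((p.1 : torusT W) : GA W))⁻¹ * GA.ofFinPart W γ₀ * ((p.2 : torusT' W) : GA W)) ≠ 0} := by
  -- σ-finiteness of the Haar measures on the factor tori, as in FINSUM
  haveI := locallyCompact_GA W
  haveI := secondCountable_GA W
  haveI := locallyCompactSpace_torusT W
  haveI := locallyCompactSpace_torusT' W
  haveI : SecondCountableTopology (torusT W) :=
    TopologicalSpace.Subtype.secondCountableTopology (torusT W : Set (GA W))
  haveI : SecondCountableTopology (torusT' W) :=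
    TopologicalSpace.Subtype.secondCountableTopology (torusT' W : Set (GA W))
  haveI : SecondCountableTopology (torusFin W) :=
    TopologicalSpace.Subtype.secondCountableTopology (torusFin W : Set (torusT W))
  haveI : SecondCountableTopology (torusFin' W) :=
    TopologicalSpace.Subtype.secondCountableTopology (torusFin' W : Set (torusT' W))
  haveI : LocallyCompactSpace (torusFin W) := (isClosed_torusFin W).locallyCompactSpace
  haveI : LocallyCompactSpace (torusFin' W) := (isClosed_torusFin' W).locallyCompactSpace
  haveI : IsLocallyFiniteMeasure νf := isLocallyFiniteMeasure_of_isFiniteMeasureOnCompacts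
  haveI : IsLocallyFiniteMeasure νf' := isLocallyFiniteMeasure_of_isFiniteMeasureOnCompacts
  haveI : SigmaFinite νf := sigmaFinite_of_locallyFinite
  haveI : SigmaFinite νf' := sigmaFinite_of_locallyFinite
  haveI : BorelSpace (torusFin W) := Subtype.borelSpace _
  haveI : BorelSpace (torusFin' W) := Subtype.borelSpace _
  -- the open neighbourhood `V ⊆ DZ_f` of `1`
  obtain ⟨U, hU1, hUD⟩ := hU
  obtain ⟨V, hVU, hVo, hV1⟩ := mem_nhds_iff.1 hU1
  -- the two open sets
  set A : Set (torusFin W) := V ∩ {b : torusFin W | ((b : torusT W) : GA W) ∈ levelK W N} with hA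
  set B : Set (torusFin' W) := {b : torusFin' W | ((b : torusT' W) : GA W) ∈ levelK W N} with hB
  have hAo : IsOpen A := hVo.inter (isOpen_coe_mem_levelK W hN)
  have hBo : IsOpen B := isOpen_coe_mem_levelK' W hN
  have hA1 : (1 : torusFin W) ∈ A := ⟨hV1, by
    show ((((1 : torusFin W) : torusT W)) : GA W) ∈ levelK W N
    simp only [OneMemClass.coe_one]
    exact one_mem _⟩
  have hB1 : (1 : torusFin' W) ∈ B := by
    show ((((1 : torusFin' W) : torusT' W)) : GA W) ∈ levelK W N
    simp only [OneMemClass.coe_one]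
    exact one_mem _
  -- `A ×ˢ B` lies in the support set
  have hsub : A ×ˢ B ⊆ {p : torusFin W × torusFin' W |
      Ffin ((((p.1 : torusT W) : GA W))⁻¹ * GA.ofFinPart W γ₀ * ((p.2 : torusT' W) : GA W)) ≠ 0} := by
    rintro ⟨b, b'⟩ ⟨⟨-, hb⟩, hb'⟩
    refine hF _ ?_
    exact Set.mul_mem_mul (Set.mul_mem_mul (inv_mem hb) (Set.mem_singleton _)) hb'
  refine lt_of_lt_of_le ?_ (measure_mono hsub)
  rw [Measure.prod_prod, Measure.restrict_apply hAo.measurableSet,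
    Set.inter_eq_left.2 ((Set.inter_subset_left).trans (hVU.trans hUD))]
  exact ENNReal.mul_pos (hAo.measure_pos νf ⟨1, hA1⟩).ne' (hBo.measure_pos νf' ⟨1, hB1⟩).ne'

end FinSupp

end Summit.Ventures.HodgeRepro.Tier4.Line4

end
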